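import Literature.MathematicalPhysics.QuantumFieldTheory.BalabanImbrieJaffe1984to88.BIJ88SecondOrder5133

/-!
# `BalabanImbrieJaffe1984to88.BIJ88CondMoments305` — T. Bałaban, J. Imbrie, A. Jaffe, *Effective action and cluster properties of the abelian
Higgs model*, Commun. Math. Phys. **114** (1988) 257–315 [BalabanImbrieJaffe1988], Sect. 5.13 p. 305–307 [PDF 49–51], with T. Bałaban,
*(Higgs)₂,₃ quantum fields in a finite volume. II. An upper bound*, Commun. Math. Phys. **86** (1982) 555–594 [Balaban1982Higgs2] (2.28)–(2.29)
p. 563 [PDF 9]: **CONDITIONAL FIRST AND SECOND MOMENTS OF THE INTERPOLATED GAUSSIAN FIELD** — the smoothness-free entrance to the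
p. 307 mechanism (*"Each time some □_i's are joined, we have s-derivatives, which produce functional derivatives, chains of covariances
C_ω(α), and factors ℱ = O(e^{−cr(e_k)})"*) for observables that depend only on the fields of a set of cubes: instead of integrating by parts
ON THE OBSERVABLE (p13's walk form `BIJ88WalkFormOrderOne5133.dexp_singleton_walk`, which needs `H ∈ C²`), one integrates out the fields the
observable does not see by the conditional Gaussian integration (2.28) of [Balaban1982Higgs2] — PROVED in the tree carrier
`Balaban1983to89.B2Eq228Conditioning` (`integral_conditioning`) — and computes the conditional first and second moments explicitly:
for sites `i, j` of `Λ` (the integrated fields) and a measurable `G` of the fields on `Λᶜ`,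

  `∫ e^{−½⟨φ,Aφ⟩}e^{⟨f,φ⟩} φ_i φ_j G(φ↾Λᶜ) dφ = ∫ e^{−½⟨φ,Aφ⟩}e^{⟨f,φ⟩} [ (A_Λ⁻¹)_{ij} + μ(φ↾Λᶜ)_i μ(φ↾Λᶜ)_j ] G(φ↾Λᶜ) dφ`,

`μ(y) = A_Λ⁻¹(f↾Λ − A_{ΛΛᶜ}y)` the printed shift (`condShift`; its (2.29) boundary form `BIJ88…B2Eq228Conditioning.shift_eq_sum_boundary` is
where the DECAY of `C_Λ^{(0)} = A_Λ⁻¹` enters).  The mean-zero / covariance-`M⁻¹` facts for `dμ_{M⁻¹} = gaussProb M` are read off Mathlib's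
`multivariateGaussian` exactly as the typer's `Balaban1983to89.HiggsCondGaussMoments` does for the concrete scalar field (same three Mathlib
lemmas: `measurePreserving_eval_multivariateGaussian`, `covariance_eval_multivariateGaussian`, `IsGaussian.memLp_dual`), here for an ARBITRARY
positive definite precision on a finite index type — the generality p13's engine (`BIJ88SecondOrder5133.num`, precision `Δ_s = interpForm blk Δ s`)
needs.

statement-level skeleton of published theorems with citation tags; proofs where landed; nothing here is a claim about the Yang–Mills mass gap

PDF held: `paper:balaban1988-cmp114-bij-abelian-higgs-effective-action` (journal page = PDF page + 256); p. 307, verbatim (text layer p0051):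
*"Each time some □_i's are joined, we have s-derivatives, which produce functional derivatives, chains of covariances C_ω(α), and factors
ℱ = O(e^{−cr(e_k)}). … If the walk ω(α) wanders through more than a few cubes, we begin to pickup factors e^{−cr(e_k)}."*; [Balaban1982Higgs2]
p. 563, verbatim (quoted in full in `B2Eq228Conditioning`): *"it will be a conditional integration with conditioning on Λ₅ᶜ. … where dμ_{A_Λ⁻¹}
is a probabilistic Gaussian measure with the covariance A_Λ⁻¹."*

WHAT IS PROVED (unit `lit-balaban-p36`, generation 19 of the Phase-2 proof seat p36; SKELETON rows C2.Eq5.14.3-5.14.4 / C2.Eq5.13.3-5.13.4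
of `HOME/lit-balaban-r16/ROWS-C2-part2.md`, owner r16 — engine-level infrastructure for the re-scoped flip item (v2.253: (5.14.4) located on
`|X_β| ≥ 3` under (i) a decay letter on `C_s`, (ii) the located V-surplus clause); 0 definitions, 0 `Prop` facts, theorems only).
* §1 `dμ_{M⁻¹}` for ANY positive definite `M` on a finite type: `map_toLp_gaussProb` (it IS `multivariateGaussian 0 M⁻¹`), `integral_apply_gaussProb`
  (mean `0`), `covariance_apply_gaussProb` (`= M⁻¹ᵢⱼ`), `memLp_apply_gaussProb`, `integrable_apply_gaussProb`, `integrable_mul_apply_gaussProb`,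
  `integral_mul_apply_gaussProb` (`∫ xᵢxⱼ = M⁻¹ᵢⱼ`), and the shifted moments `integral_add_apply_gaussProb` (`∫ (x+m)ᵢ = mᵢ`),
  `integral_add_mul_add_apply_gaussProb` (`∫ (x+m)ᵢ(x+m)ⱼ = M⁻¹ᵢⱼ + mᵢmⱼ`).
* §2 the inner integral of (2.28) on coordinates: `inner_const`, `inner_apply` (`= μ(y)ᵢ`), `inner_mul_apply` (`= (A_Λ⁻¹)ᵢⱼ + μ(y)ᵢμ(y)ⱼ`).
* §3 Gaussian growth of the coordinate monomials times a bounded factor (`norm_apply_mul_le_growth`, `norm_mul_mul_le_growth`) and the two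
  CONDITIONAL-MOMENT IDENTITIES under `∫ · e^{−½⟨φ,Aφ⟩}e^{⟨f,φ⟩}dφ` for `A ≻ 0` with a lower form bound: **`integral_apply_mul_conditioning`**
  (first moment) and **`integral_mul_mul_conditioning`** (the display above).
HONEST SCOPE: Gaussian calculus only; no (5.14.4) estimate, no letters; the use (p13's `dexp {n}` for a far cube `n` = a covariance with the
observable of a quadratic form in the CONDITIONAL MEAN, where the decay letter (i) is consumed) is the sequel `BIJ88DexpCondMean305`.  Imports
`BIJ88SecondOrder5133` (p13; for `integrable_growth_of_lower`, which imports the B2 carrier); modifies nothing.  NOT summit progress; NOT continuum;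
NOT Clay.  Cell `lit-balaban` Phase 2, seat p36 gen 19 (owner r16, referee ref-5).
-/

noncomputable section

open MeasureTheory ProbabilityTheory Matrix Finset
open scoped BigOperators

namespace Literature.MathematicalPhysics.QuantumFieldTheory.BalabanImbrieJaffe1984to88.BIJ88CondMoments305

open Literature.MathematicalPhysics.QuantumFieldTheory.Balaban1983to89
open B2Eq228Conditioning (In Out resIn resOut glue blkIn blkMix condShift inner weight source gaussProb
  gaussProb_eq_map_multivariateGaussian isProbabilityMeasure_gaussProb integral_conditioning measurable_resOut)
open BIJ88SecondOrder5133 (integrable_growth_of_lower)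

/-! ## §1 First and second moments of `dμ_{M⁻¹} = gaussProb M`, any positive definite `M` -/

section GaussProb

variable {κ : Type} [Fintype κ] [DecidableEq κ] {M : Matrix κ κ ℝ}

/-- `dμ_{M⁻¹}` read on `EuclideanSpace ℝ κ` is Mathlib's `multivariateGaussian 0 M⁻¹` (p15's `gaussProb_eq_map_multivariateGaussian`).
[cite: Balaban1982Higgs2, (2.28) p.563] -/
theorem map_toLp_gaussProb (hM : M.PosDef) :
    (gaussProb M).map ⇑(MeasurableEquiv.toLp 2 (κ → ℝ)) = multivariateGaussian 0 M⁻¹ := by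
  set e := MeasurableEquiv.toLp 2 (κ → ℝ) with he
  rw [gaussProb_eq_map_multivariateGaussian hM, Measure.map_map e.measurable e.symm.measurable,
    MeasurableEquiv.self_comp_symm, Measure.map_id]

/-- The covariance matrix `M⁻¹` is positive semidefinite. [folklore] [cite: Balaban1982Higgs2, (2.28) p.563] -/
theorem inv_posSemidef (hM : M.PosDef) : (M⁻¹).PosSemidef := hM.inv.posSemidef

/-- **Mean zero**: `∫ xᵢ dμ_{M⁻¹}(x) = 0`. [cite: Balaban1982Higgs2, (2.28) p.563] -/
theorem integral_apply_gaussProb (hM : M.PosDef) (i : κ) : ∫ x, x i ∂(gaussProb M) = 0 := by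
  set e := MeasurableEquiv.toLp 2 (κ → ℝ) with he
  have hS := inv_posSemidef hM
  have hX : Measurable (fun y : EuclideanSpace ℝ κ => y i) := by fun_prop
  have h1 : ∫ x, x i ∂(gaussProb M) = ∫ y, (fun y : EuclideanSpace ℝ κ => y i) y ∂((gaussProb M).map ⇑e) := by
    rw [integral_map e.measurable.aemeasurable hX.aestronglyMeasurable]
    rfl
  rw [h1, map_toLp_gaussProb hM]
  have h2 := (measurePreserving_eval_multivariateGaussian (μ := (0 : EuclideanSpace ℝ κ)) hS (i := i)).map_eq
  have h3 : ∫ t, t ∂((multivariateGaussian 0 M⁻¹).map (fun y : EuclideanSpace ℝ κ => y i))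
      = ∫ y, (fun y : EuclideanSpace ℝ κ => y i) y ∂(multivariateGaussian 0 M⁻¹) :=
    integral_map (φ := fun y : EuclideanSpace ℝ κ => y i) (f := fun t : ℝ => t) hX.aemeasurable aestronglyMeasurable_id
  rw [← h3, h2, integral_id_gaussianReal]
  simp

/-- **Covariance `M⁻¹`**: `cov[xᵢ, xⱼ; dμ_{M⁻¹}] = (M⁻¹)ᵢⱼ` ([Balaban1982Higgs2] p. 563 *"a probabilistic Gaussian measure with the covariance
A_Λ⁻¹"*). [cite: Balaban1982Higgs2, (2.28) p.563] -/
theorem covariance_apply_gaussProb (hM : M.PosDef) (i j : κ) :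
    cov[fun x : κ → ℝ => x i, fun x => x j; gaussProb M] = M⁻¹ i j := by
  set e := MeasurableEquiv.toLp 2 (κ → ℝ) with he
  have hS := inv_posSemidef hM
  have hXa : Measurable (fun y : EuclideanSpace ℝ κ => y i) := by fun_prop
  have hXb : Measurable (fun y : EuclideanSpace ℝ κ => y j) := by fun_prop
  have h := covariance_map (μ := gaussProb M) hXa.aestronglyMeasurable hXb.aestronglyMeasurable e.measurable.aemeasurable
  rw [map_toLp_gaussProb hM, covariance_eval_multivariateGaussian hS] at h
  rw [h]
  rfl

/-- The coordinates are square integrable under `dμ_{M⁻¹}`. [cite: Balaban1982Higgs2, (2.28) p.563] -/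
theorem memLp_apply_gaussProb (hM : M.PosDef) (i : κ) : MemLp (fun x : κ → ℝ => x i) 2 (gaussProb M) := by
  set e := MeasurableEquiv.toLp 2 (κ → ℝ) with he
  have hG : MemLp (fun y : EuclideanSpace ℝ κ => y i) 2 ((gaussProb M).map ⇑e) := by
    rw [map_toLp_gaussProb hM, ← EuclideanSpace.coe_proj ℝ]
    exact IsGaussian.memLp_dual _ (EuclideanSpace.proj i) 2 (by simp)
  exact hG.comp_of_map e.measurable.aemeasurable

/-- The coordinates are integrable under `dμ_{M⁻¹}`. [cite: Balaban1982Higgs2, (2.28) p.563] -/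
theorem integrable_apply_gaussProb (hM : M.PosDef) (i : κ) : Integrable (fun x : κ → ℝ => x i) (gaussProb M) := by
  haveI := isProbabilityMeasure_gaussProb hM
  exact (memLp_apply_gaussProb hM i).integrable one_le_two

/-- Products of two coordinates are integrable under `dμ_{M⁻¹}`. [cite: Balaban1982Higgs2, (2.28) p.563] -/
theorem integrable_mul_apply_gaussProb (hM : M.PosDef) (i j : κ) : Integrable (fun x : κ → ℝ => x i * x j) (gaussProb M) :=
  (memLp_apply_gaussProb hM i).integrable_mul (memLp_apply_gaussProb hM j)

/-- **Second moments `∫ xᵢxⱼ dμ_{M⁻¹} = (M⁻¹)ᵢⱼ`** (centred). [cite: Balaban1982Higgs2, (2.28) p.563] -/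
theorem integral_mul_apply_gaussProb (hM : M.PosDef) (i j : κ) : ∫ x, x i * x j ∂(gaussProb M) = M⁻¹ i j := by
  haveI := isProbabilityMeasure_gaussProb hM
  have h := covariance_eq_sub (memLp_apply_gaussProb hM i) (memLp_apply_gaussProb hM j)
  rw [covariance_apply_gaussProb hM i j] at h
  have h1 : (fun x : κ → ℝ => x i) * (fun x => x j) = fun x => x i * x j := rfl
  rw [h1, integral_apply_gaussProb hM i, integral_apply_gaussProb hM j, mul_zero, sub_zero] at h
  exact h.symm

/-- Shifted first moment: `∫ (x + m)ᵢ dμ_{M⁻¹}(x) = mᵢ`. [cite: Balaban1982Higgs2, (2.28) p.563] -/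
theorem integral_add_apply_gaussProb (hM : M.PosDef) (m : κ → ℝ) (i : κ) : ∫ x, (x + m) i ∂(gaussProb M) = m i := by
  haveI := isProbabilityMeasure_gaussProb hM
  simp only [Pi.add_apply]
  rw [integral_add (integrable_apply_gaussProb hM i) (integrable_const _), integral_apply_gaussProb hM i, integral_const]
  simp

/-- Shifted second moment: `∫ (x + m)ᵢ(x + m)ⱼ dμ_{M⁻¹}(x) = (M⁻¹)ᵢⱼ + mᵢmⱼ`. [cite: Balaban1982Higgs2, (2.28) p.563] -/
theorem integral_add_mul_add_apply_gaussProb (hM : M.PosDef) (m : κ → ℝ) (i j : κ) :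
    ∫ x, (x + m) i * (x + m) j ∂(gaussProb M) = M⁻¹ i j + m i * m j := by
  haveI := isProbabilityMeasure_gaussProb hM
  have hsplit : ∀ x : κ → ℝ, (x + m) i * (x + m) j = x i * x j + (m j * x i + m i * x j + m i * m j) := fun x => by
    simp only [Pi.add_apply]; ring
  simp_rw [hsplit]
  have h1 := integrable_mul_apply_gaussProb hM i j
  have ha : Integrable (fun x : κ → ℝ => m j * x i) (gaussProb M) := (integrable_apply_gaussProb hM i).const_mul _
  have hb : Integrable (fun x : κ → ℝ => m i * x j) (gaussProb M) := (integrable_apply_gaussProb hM j).const_mul _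
  have hab : Integrable (fun x : κ → ℝ => m j * x i + m i * x j) (gaussProb M) := ha.add hb
  have hc : Integrable (fun _ : κ → ℝ => m i * m j) (gaussProb M) := integrable_const _
  have h2 : Integrable (fun x : κ → ℝ => m j * x i + m i * x j + m i * m j) (gaussProb M) := hab.add hc
  have hIa : ∫ x : κ → ℝ, m j * x i ∂(gaussProb M) = 0 := by rw [integral_const_mul, integral_apply_gaussProb hM i, mul_zero]
  have hIb : ∫ x : κ → ℝ, m i * x j ∂(gaussProb M) = 0 := by rw [integral_const_mul, integral_apply_gaussProb hM j, mul_zero]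
  have hIc : ∫ _ : κ → ℝ, m i * m j ∂(gaussProb M) = m i * m j := by rw [integral_const]; simp
  rw [integral_add h1 h2, integral_mul_apply_gaussProb hM, integral_add hab hc, integral_add ha hb, hIa, hIb, hIc]
  ring

end GaussProb

/-! ## §2 The inner integral of (2.28) on the coordinate monomials -/

section Inner

variable {α : Type} [Fintype α] [DecidableEq α] (p : α → Prop) [DecidablePred p] {A : Matrix α α ℝ} (f : α → ℝ)

/-- `∫dμ_{A_Λ⁻¹} c = c`. [cite: Balaban1982Higgs2, (2.28) p.563] -/
theorem inner_const (hA : A.PosDef) (c : ℝ) (y : Out p → ℝ) : B2Eq228Conditioning.inner p A f (fun _ => c) y = c := by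
  have hIn : (blkIn p A).PosDef := by unfold blkIn; exact hA.submatrix Subtype.val_injective
  haveI := isProbabilityMeasure_gaussProb hIn
  rw [B2Eq228Conditioning.inner, integral_const]
  simp

/-- **Conditional first moment**: `∫dμ_{A_Λ⁻¹}(φ′) (φ′ + μ(y))ᵢ = μ(y)ᵢ`, `μ(y) = A_Λ⁻¹(f↾Λ − A_{ΛΛᶜ}y)` the printed shift.
[cite: Balaban1982Higgs2, (2.28) p.563] -/
theorem inner_apply (hA : A.PosDef) (i : In p) (y : Out p → ℝ) : B2Eq228Conditioning.inner p A f (fun x => x i) y = condShift p A f y i := by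
  have hIn : (blkIn p A).PosDef := by unfold blkIn; exact hA.submatrix Subtype.val_injective
  rw [B2Eq228Conditioning.inner]
  exact integral_add_apply_gaussProb hIn _ i

/-- **Conditional second moment**: `∫dμ_{A_Λ⁻¹}(φ′) (φ′ + μ(y))ᵢ(φ′ + μ(y))ⱼ = (A_Λ⁻¹)ᵢⱼ + μ(y)ᵢμ(y)ⱼ`.
[cite: Balaban1982Higgs2, (2.28) p.563] -/
theorem inner_mul_apply (hA : A.PosDef) (i j : In p) (y : Out p → ℝ) :
    B2Eq228Conditioning.inner p A f (fun x => x i * x j) y = (blkIn p A)⁻¹ i j + condShift p A f y i * condShift p A f y j := by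
  have hIn : (blkIn p A).PosDef := by unfold blkIn; exact hA.submatrix Subtype.val_injective
  rw [B2Eq228Conditioning.inner]
  exact integral_add_mul_add_apply_gaussProb hIn _ i j

end Inner

/-! ## §3 The conditional-moment identities under `∫ · e^{−½⟨φ,Aφ⟩}e^{⟨f,φ⟩}dφ` -/

section Conditioning

variable {α : Type} [Fintype α] [DecidableEq α] (p : α → Prop) [DecidablePred p] {A : Matrix α α ℝ} (f : α → ℝ)
  {G₀ : (Out p → ℝ) → ℝ}

omit [DecidableEq α] in
/-- `u ≤ ε⁻¹e^{εu}` for `ε > 0`. [folklore] [cite: BalabanImbrieJaffe1988, §5.13 p.305] -/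
theorem le_inv_mul_exp {ε : ℝ} (hε : 0 < ε) (u : ℝ) : u ≤ ε⁻¹ * Real.exp (ε * u) := by
  have h := Real.add_one_le_exp (ε * u)
  rw [le_inv_mul_iff₀ hε]
  linarith

omit [DecidableEq α] in
/-- A coordinate square is at most `‖φ‖²`. [folklore] [cite: BalabanImbrieJaffe1988, §5.13 p.305] -/
theorem sq_apply_le_dotProduct (φ : α → ℝ) (x : α) : φ x ^ 2 ≤ φ ⬝ᵥ φ := by
  rw [dotProduct, sq]
  exact Finset.single_le_sum (fun y _ => mul_self_nonneg (φ y)) (Finset.mem_univ x)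

omit [DecidableEq α] [DecidablePred p] in
/-- Gaussian growth of `φᵢ·G(φ↾Λᶜ)`: `|φᵢ G| ≤ CG(1 + ε⁻¹)/2 · e^{ε‖φ‖²}`. [folklore] [cite: BalabanImbrieJaffe1988, §5.13 p.305] -/
theorem norm_apply_mul_le_growth {CG : ℝ} (hGb : ∀ y, |G₀ y| ≤ CG) {ε : ℝ} (hε : 0 < ε) (i : α) (φ : α → ℝ) :
    ‖φ i * G₀ (resOut p φ)‖ ≤ CG * ((1 + ε⁻¹) / 2) * Real.exp (ε * (φ ⬝ᵥ φ)) := by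
  have hCG : 0 ≤ CG := (abs_nonneg _).trans (hGb (resOut p φ))
  have h1 : |φ i| ≤ (1 + φ ⬝ᵥ φ) / 2 := by
    have h := sq_apply_le_dotProduct φ i
    have h' : 0 ≤ (|φ i| - 1) ^ 2 := sq_nonneg _
    rw [← sq_abs] at h
    nlinarith
  have hE : 1 ≤ Real.exp (ε * (φ ⬝ᵥ φ)) := Real.one_le_exp (mul_nonneg hε.le (by
    rw [dotProduct]; exact Finset.sum_nonneg fun y _ => mul_self_nonneg _))
  have h2 : (1 + φ ⬝ᵥ φ) / 2 ≤ (1 + ε⁻¹) / 2 * Real.exp (ε * (φ ⬝ᵥ φ)) := by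
    have h := le_inv_mul_exp hε (φ ⬝ᵥ φ)
    have hε' : 0 ≤ ε⁻¹ := inv_nonneg.2 hε.le
    nlinarith
  rw [norm_mul, Real.norm_eq_abs, Real.norm_eq_abs]
  calc |φ i| * |G₀ (resOut p φ)| ≤ (1 + ε⁻¹) / 2 * Real.exp (ε * (φ ⬝ᵥ φ)) * CG :=
        mul_le_mul (h1.trans h2) (hGb _) (abs_nonneg _) (by positivity)
    _ = CG * ((1 + ε⁻¹) / 2) * Real.exp (ε * (φ ⬝ᵥ φ)) := by ring

omit [DecidableEq α] [DecidablePred p] in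
/-- Gaussian growth of `φᵢφⱼ·G(φ↾Λᶜ)`: `|φᵢφⱼ G| ≤ CG ε⁻¹ e^{ε‖φ‖²}`. [folklore] [cite: BalabanImbrieJaffe1988, §5.13 p.305] -/
theorem norm_mul_mul_le_growth {CG : ℝ} (hGb : ∀ y, |G₀ y| ≤ CG) {ε : ℝ} (hε : 0 < ε) (i j : α) (φ : α → ℝ) :
    ‖φ i * φ j * G₀ (resOut p φ)‖ ≤ CG * ε⁻¹ * Real.exp (ε * (φ ⬝ᵥ φ)) := by
  have hCG : 0 ≤ CG := (abs_nonneg _).trans (hGb (resOut p φ))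
  have h1 : |φ i * φ j| ≤ φ ⬝ᵥ φ := by
    rw [abs_mul]
    have hi := sq_apply_le_dotProduct φ i
    have hj := sq_apply_le_dotProduct φ j
    rw [← sq_abs] at hi hj
    nlinarith [sq_nonneg (|φ i| - |φ j|), abs_nonneg (φ i), abs_nonneg (φ j)]
  have h2 := le_inv_mul_exp hε (φ ⬝ᵥ φ)
  rw [norm_mul, Real.norm_eq_abs, Real.norm_eq_abs]
  calc |φ i * φ j| * |G₀ (resOut p φ)| ≤ ε⁻¹ * Real.exp (ε * (φ ⬝ᵥ φ)) * CG :=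
        mul_le_mul (h1.trans h2) (hGb _) (abs_nonneg _) (by positivity)
    _ = CG * ε⁻¹ * Real.exp (ε * (φ ⬝ᵥ φ)) := by ring

/-- **Conditional first moment under the full integral**: for `i ∈ Λ` and `G` bounded measurable on the `Λᶜ`-fields,
`∫ e^{−½⟨φ,Aφ⟩}e^{⟨f,φ⟩} φᵢ G(φ↾Λᶜ) dφ = ∫ e^{−½⟨φ,Aφ⟩}e^{⟨f,φ⟩} μ(φ↾Λᶜ)ᵢ G(φ↾Λᶜ) dφ` — (2.28) with `F(φ↾Λ) = φᵢ` and the inner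
integral evaluated (`inner_apply`). [cite: Balaban1982Higgs2, (2.28) p.563] -/
theorem integral_apply_mul_conditioning (hA : A.PosDef) {c : ℝ} (hc : 0 < c)
    (hcA : ∀ v, c * (v ⬝ᵥ v) ≤ v ⬝ᵥ (A *ᵥ v)) (hG : Measurable G₀) {CG : ℝ} (hGb : ∀ y, |G₀ y| ≤ CG) (i : In p) :
    ∫ φ, weight A φ * (source f φ * φ i * G₀ (resOut p φ))
      = ∫ φ, weight A φ * (source f φ * G₀ (resOut p φ) * condShift p A f (resOut p φ) i) := by
  have hF : Measurable (fun x : In p → ℝ => x i) := measurable_pi_apply i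
  have hε : 2 * (c / 4) < c := by linarith
  have hint := integrable_growth_of_lower hcA f (G := fun φ : α → ℝ => φ i * G₀ (resOut p φ))
    (((measurable_pi_apply (i : α)).mul (hG.comp (measurable_resOut p))).aestronglyMeasurable) hε
    (fun φ => norm_apply_mul_le_growth p hGb (by linarith : 0 < c / 4) i φ)
  have hint' : Integrable fun φ : α → ℝ =>
      weight A φ * (source f φ * (fun x : In p → ℝ => x i) (resIn p φ) * G₀ (resOut p φ)) := by
    refine hint.congr (Filter.Eventually.of_forall fun φ => ?_)
    simp only [resIn]
    ring
  have key := integral_conditioning p A f hA hF hG hint'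
  simp only [resIn] at key
  simp_rw [inner_apply p f hA i] at key
  exact key

/-- **Conditional second moment under the full integral**: for `i, j ∈ Λ` and `G` bounded measurable on the `Λᶜ`-fields,
`∫ e^{−½⟨φ,Aφ⟩}e^{⟨f,φ⟩} φᵢφⱼ G(φ↾Λᶜ) dφ = ∫ e^{−½⟨φ,Aφ⟩}e^{⟨f,φ⟩} [(A_Λ⁻¹)ᵢⱼ + μ(φ↾Λᶜ)ᵢ μ(φ↾Λᶜ)ⱼ] G(φ↾Λᶜ) dφ` — (2.28) with
`F(φ↾Λ) = φᵢφⱼ` and the inner integral evaluated (`inner_mul_apply`): a bilinear observable of the integrated fields is, against any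
observable of the remaining fields, the same bilinear observable OF THE CONDITIONAL MEAN plus the constant `(A_Λ⁻¹)ᵢⱼ`.
[cite: Balaban1982Higgs2, (2.28) p.563] -/
theorem integral_mul_mul_conditioning (hA : A.PosDef) {c : ℝ} (hc : 0 < c)
    (hcA : ∀ v, c * (v ⬝ᵥ v) ≤ v ⬝ᵥ (A *ᵥ v)) (hG : Measurable G₀) {CG : ℝ} (hGb : ∀ y, |G₀ y| ≤ CG) (i j : In p) :
    ∫ φ, weight A φ * (source f φ * (φ i * φ j) * G₀ (resOut p φ))
      = ∫ φ, weight A φ * (source f φ * G₀ (resOut p φ) *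
          ((blkIn p A)⁻¹ i j + condShift p A f (resOut p φ) i * condShift p A f (resOut p φ) j)) := by
  have hF : Measurable (fun x : In p → ℝ => x i * x j) := (measurable_pi_apply i).mul (measurable_pi_apply j)
  have hε : 2 * (c / 4) < c := by linarith
  have hint := integrable_growth_of_lower hcA f (G := fun φ : α → ℝ => φ i * φ j * G₀ (resOut p φ))
    ((((measurable_pi_apply (i : α)).mul (measurable_pi_apply (j : α))).mul
      (hG.comp (measurable_resOut p))).aestronglyMeasurable) hε
    (fun φ => norm_mul_mul_le_growth p hGb (by linarith : 0 < c / 4) i j φ)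
  have hint' : Integrable fun φ : α → ℝ =>
      weight A φ * (source f φ * (fun x : In p → ℝ => x i * x j) (resIn p φ) * G₀ (resOut p φ)) := by
    refine hint.congr (Filter.Eventually.of_forall fun φ => ?_)
    simp only [resIn]
    ring
  have key := integral_conditioning p A f hA hF hG hint'
  simp only [resIn] at key
  simp_rw [inner_mul_apply p f hA i j] at key
  exact key

end Conditioning

end Literature.MathematicalPhysics.QuantumFieldTheory.BalabanImbrieJaffe1984to88.BIJ88CondMoments305

end
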